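import Mathlib
import Literature.MathematicalPhysics.QuantumFieldTheory.Balaban1983to89.Beta.OneLoop

/-!
# `Balaban1983to89.Beta.ConstraintElimination` — the constraint-elimination identity for the bordered (KKT)
determinant of the constrained Gaussian `Z^{(k)}(U)` of [Balaban1987RG1] (1.4), in Bałaban's adapted coordinates
`B′ = CB̃` of [Balaban1985BackgroundPropagators] (3.157): `det [[Δ, Qᵀ],[Q, 0]] = (−1)^m · det(CᵀΔC) · (det Q_κ)²`,
hence `log Z^{(k)} = log Z′^{(k)} − log |det Q_κ|` EXACTLY (kernel discharge of the cell's proof obligation GAPS C-beta-6,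
determinant half; the Gaussian-integral half is a sibling module)

CITATION HEADER (lean-in-tree rule 2026-08-18).  Sources: T. Bałaban, *Renormalization group approach to lattice gauge
field theories. I. Generation of effective actions in a small field approximation and a coupling constant
renormalization in four dimensions*, Commun. Math. Phys. **109**, 249–301 (1987) [Balaban1987RG1] (held
`paper:balaban1987-cmp109-rg-i-small-field`; journal page = PDF page + 248); T. Bałaban, *Propagators for lattice gauge
theories in a background field*, Commun. Math. Phys. **99**, 389–434 (1985) [Balaban1985BackgroundPropagators]
(journal page = PDF page + 388).  Every sentence quoted below was read from the x2 page renders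
(`run/shared/lean/pub/pub-balaban/b2b-balaban-ref1/pages/1987-cmp109-rg-I-small-field/…-p012,-p019,-p020-x2.png`,
`…/1985-cmp99-background-propagators/…-p039,-p040-x2.png`), not from an OCR layer; prose companion
`run/shared/lean/pub/pub-balaban/b2b-balaban-pv03/KKT-ELIMINATION.md`; dictionary = `BETA/OBJECTS.md` §4 (unit pv25) and
the landed definitions `Beta.ConstrainedGaussian.{kkt, logZ, reduced, logZred}` of `Beta.OneLoop` (p177267).

HONEST FRAMING (cell rule, verbatim): discharging `BetaPertH` makes Bałaban's UV stability UNCONDITIONAL — a real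
constructive-QFT result; it is NOT the continuum limit and NOT the Clay problem.  THIS MODULE ASSERTS NOTHING about the
series and nothing about β: it is finite-dimensional linear algebra over a commutative ring plus three `Real.log`
corollaries.  No statement of the manuscripts under audit is used as a hypothesis anywhere.  Value = a kernel theorem
about reals behind a definitional point of the flow-input (β) sub-cell, NOT summit progress (audit cell `pub-balaban`,
β sub-cell row BETA-0, kernel sub-part BETA-0/KKT, unit `b2b-balaban-pv03` gen 3; v1.1 = docstring-only revision by
gen 4 answering the cross-read GAPS C-b12g3-6, see the note at the end of WHAT IS PRINTED).

WHAT IS PRINTED (verbatim; the READING below each quotation is a labelled modelling step, DIVERGENCE D-pv03.8, never a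
cited fact).
* [Balaban1987RG1] (1.4) p. 260: "the factor Z^{(j)}(U_k) is given by the Gaussian integral normalizing the Gaussian
  measure for a fluctuation field in j-th step integration  Z^{(j)}(U_k) = ∫ dB δ(Q̃B) exp[−½⟨B, Δ^{(j)}(U_k)B⟩]."; p. 267:
  "This quadratic form defines the k-th normalization factor Z^{(k)}(U_{k+1}) given by the formula (1.4) with j = k."
  READING (= `Beta.ConstrainedGaussian.logZ`, OBJECTS.md §4): `log Z = ((n−m)/2)·log 2π − ½·log|det [[Δ,Qᵀ],[Q,0]]|`
  for an `m × n` constraint matrix `Q` and an `n × n` form `Δ`.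
* [Balaban1987RG1] p. 267: "At first we introduce an operator h. It transforms g-valued functions B defined at bonds
  of the lattice T^{(k+1)} into such functions defined at bonds of T^{(k)}. The function hB is equal to 0 everywhere,
  except the set {b₀(c): c ∈ T^{(k+1)}}. [Let us recall that for c ∈ T^{(k+1)} the bond b₀(c) is defined as the bond of
  the lattice T^{(k)} contained in c and belonging to the corridor B(c) = {b ∈ T^{(k)} : b₋ ∈ B(c₋), b₊ ∈ B(c₊)}.]
  Furthermore, the operator h satisfies the identity LQ̃h = I on T^{(k+1)}. Of course h is uniquely defined by these
  conditions, in fact it is a very simple operator given by the equality (hB)(b₀(c)) = h(c)B(c), where h(c) is a linear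
  operator on the Lie algebra g, equal to an inverse of a coefficient at the variable B′(b₀(c)) in (Q̃B′)(c), multiplied
  by L^{−1}."  (So `hB` is supported on the bonds `b₀(c)` — this paraphrase is ours, not print.)  p. 267 last line –
  p. 268 l. 1–4: "We perform the same operation as in the first step, namely using the δ-functions δ(Q̃B′) we eliminate
  the variables B′(b₀(c)), c ∈ T^{(k+1)}. Denoting the remaining variables by B we have B′ = CB, C is the operator
  determined by the configuration V^{(k)}, and the measure becomes a Gaussian measure in variables B, with the
  covariance C^{(k)} = C^{(k)}(U_{k+1}) = (C*Δ^{(k)}C)^{−1}."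
  [Balaban1985BackgroundPropagators] p. 428, after (3.156): "We can parametrize this subspace in the same way as in [4]
  (2.154–2.155), using part of the variables B, which we denote by B̃. … Variables B depend linearly on B̃ and we have
  B = CB̃, where C is a linear operator. It is an identity operator on almost all bonds, except the bonds b₀ for which a
  value (CB̃)(b₀) is equal to a solution of the equation (QB)(c) = 0, considered as an equation on the variable B(b₀).
  This implies that the operator C is almost local, a value (CB̃)(b) depends on B̃ restricted to several blocks
  surrounding the bond b.", and (3.157)–(3.158): "e^{½⟨g,C^{(k)}(Λ)g⟩} = (Z′^{(k)}(Λ))^{−1} ∫ dB̃ exp[−½⟨B̃, C*Δ_kCB̃⟩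
  + ⟨B̃, C*g⟩] = e^{½⟨C*g,(C*Δ_kC)^{−1}C*g⟩}, hence … (C*Δ_kC)^{−1} = C̃^{(k)}(Λ)".
  (v1.1, docstring only, answering the cross-read GAPS C-b12g3-6 R1–R4: the v1 header carried three non-printed
  lead-ins inside quotation marks — «It is easy to see that», «At first let us notice that using the linear
  restriction», «we remove the restrictions introducing new variables B̃ connected with B by a linear transformation …
  defined on functions B̃» — a dropped word «Lie», a non-printed trailing clause «(hB)(b) = 0 if b is not any b₀(c)»
  and a spurious subscript in «T^{(k+1)}₁»; all replaced above by the printed words, re-read on the x2 renders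
  `…1987-cmp109-rg-I-small-field-p019-x2.png`, `…-p020-x2.png`, `…1985-cmp99-background-propagators-p040-x2.png`.
  No declaration, statement or proof changed.)
  READING (adapted coordinates): split the `n` fluctuation coordinates as `σ ⊕ κ`, `κ` = the eliminated coordinates
  (the components of the `B′(b₀(c))`, one block per `c`, so `κ` also indexes the constraints), `σ` = "the remaining
  variables"; write `Q = [Q_σ | Q_κ]` (`Matrix.fromCols`).  "LQ̃h = I" with `h` supported on the `b₀(c)` says `Q_κ` is
  invertible (indeed block-diagonal over `c` with blocks `L^{−1}h(c)^{−1}`).  Bałaban's `C` is then the `n × (n−m)`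
  matrix `elim Q_σ Q_κ := [1 ; −Q_κ⁻¹Q_σ]` (`Matrix.fromRows`): identity on `σ`, and on `κ` the solution of the
  constraint — `elim_mulVec_inl`, `constraint_mulVec_elim`, and the uniqueness `elim_unique` below are exactly the
  quoted sentence.  `Z′^{(k)}` = the Gaussian normalisation of the form `C*Δ_kC` = `Beta.ConstrainedGaussian.logZred`.

WHAT IS PROVED (all kernel-checked, imports `Mathlib` and `Beta.OneLoop` only, modifies nothing):
1. `det_fromBlocks_zero_one_one_zero`: `det [[0,1],[1,0]] = (−1)^{card κ}` over any commutative ring.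
2. `det_bordered_core`: for `A` on `σ ⊕ κ` and `q : κ × κ` with `det q` a unit,
   `det [[A, [0 ; qᵀ]], [[0 | q], 0]] = (−1)^{card κ} · det A_σσ · (det q)²` (row/column elimination by `q`, then the
   re-association `(σ ⊕ κ) ⊕ κ ≃ σ ⊕ (κ ⊕ κ)` and item 1).
3. `det_bordered_mul_det_basis_sq` (GENERAL BASIS): for any `Z : n × σ` with `QZ = 0` and `Y : n × κ` with `det(QY)` a
   unit, `det [[Δ,Qᵀ],[Q,0]] · det[Z | Y]² = (−1)^{card κ} · det(ZᵀΔZ) · det(QY)²` — the Jacobian of ANY elimination.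
4. `det_bordered_eq` (BAŁABAN'S `C`): with `Q = [Q_σ | Q_κ]`, `det Q_κ` a unit, `C = elim Q_σ Q_κ`:
   `det [[Δ,Qᵀ],[Q,0]] = (−1)^{card κ} · det(CᵀΔC) · (det Q_κ)²`; over a field `det K ≠ 0 ↔ det(CᵀΔC) ≠ 0`.
5. Real corollaries: `abs_det_bordered_eq`, `log_abs_det_bordered_eq`:
   `log|det K| = log|det(CᵀΔC)| + 2·log|det Q_κ|`.
6. BRIDGE to the landed objects (`Beta.OneLoop`): for `Z : ConstrainedGaussian n m` and an adapted splitting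
   `e : Fin n ≃ Fin r ⊕ Fin m` of the coordinates with `det Q_κ ≠ 0` and `det(CᵀΔC) ≠ 0`,
   `ConstrainedGaussian.det_kkt_eq_of_adapted` and `ConstrainedGaussian.logZ_eq_logZred_sub_log`:
   `Z.logZ = Z.logZred C − log|det Q_κ|` — the lead's "Z^{(k)}(U) = Z′^{(k)}(U)/|det Q_κ(U)|" EXACTLY; the Jacobian is a
   function of `Q̃(U)` alone.
7. Locality / invariance of the Jacobian (pure linear algebra, for the consumers' use; whether Bałaban's coefficient has
   this shape is NOT asserted here): `abs_det_blockDiagonal` (`Q_κ` block-diagonal over `c` ⇒ `|det Q_κ| = ∏_c |det q_c|`)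
   and `abs_det_smul_of_transpose_mul_self_eq_one` (`q_c = t·O`, `OᵀO = 1` ⇒ `|det q_c| = |t|^{dim}` — background-free,
   so it cancels in `log Z^{(k)}(U) − log Z^{(k)}(1)` and in the polarization Hessian).
NOT HERE (other seats, by agreement recorded in the cell journal 2026-08-18T17:56–17:58Z): the Gaussian integral itself
(`Beta/GaussianIntegral`, unit pv16); `Regular ⇒ det kkt ≠ 0`, the sign of `det kkt`, and the Gram form with
`det(CᵀC)`, `det(QQᵀ)` for an arbitrary kernel basis (unit pv23; derivable from item 3 with `Y = Qᵀ`).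
-/

namespace Literature.MathematicalPhysics.QuantumFieldTheory.Balaban1983to89.Beta.ConstraintElimination

open Matrix

/-! ## Part 1 — determinant algebra over a commutative ring -/

section CommRing

variable {R : Type*}

/-- Re-association of a `((σ ⊕ κ) ⊕ κ')`-indexed block matrix along `Equiv.sumAssoc`. [folklore] -/
theorem fromBlocks_fromBlocks_eq_submatrix {σ κ κ' : Type*} (a : Matrix σ σ R) (b : Matrix σ κ R)
    (c : Matrix κ σ R) (d : Matrix κ κ R) (u : Matrix σ κ' R) (v : Matrix κ κ' R) (w : Matrix κ' σ R)
    (x : Matrix κ' κ R) (z : Matrix κ' κ' R) :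
    fromBlocks (fromBlocks a b c d) (fromRows u v) (fromCols w x) z =
      (fromBlocks a (fromCols b u) (fromRows c w) (fromBlocks d v x z)).submatrix
        (Equiv.sumAssoc σ κ κ') (Equiv.sumAssoc σ κ κ') := by
  ext ((i | i) | i) ((j | j) | j) <;> rfl

/-- Transport of a coordinate splitting: re-indexing the fluctuation coordinates `n ≃ σ ⊕ κ` inside the bordered
matrix. [folklore] -/
theorem bordered_reindex [Zero R] {σ κ n : Type*} (Δ : Matrix n n R) (Q : Matrix κ n R) (e : n ≃ σ ⊕ κ) :
    reindex (e.sumCongr (Equiv.refl κ)) (e.sumCongr (Equiv.refl κ)) (fromBlocks Δ Qᵀ Q 0)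
      = fromBlocks (reindex e e Δ) (reindex (Equiv.refl κ) e Q)ᵀ (reindex (Equiv.refl κ) e Q) 0 := by
  ext (i | i) (j | j) <;> simp [reindex_apply]

variable [CommRing R]
variable {σ κ : Type*} [Fintype σ] [Fintype κ] [DecidableEq σ] [DecidableEq κ]

/-- The block anti-diagonal swap has determinant `(−1)^{card κ}`:  `det [[0,1],[1,0]] = (−1)^{|κ|}`.  Proof by the
unimodular factorisation `[[1,1],[0,1]]·[[0,1],[1,0]]·[[1,−1],[0,1]] = [[1,0],[1,−1]]`, valid in every characteristic.
[folklore] -/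
theorem det_fromBlocks_zero_one_one_zero :
    (fromBlocks (0 : Matrix κ κ R) (1 : Matrix κ κ R) (1 : Matrix κ κ R) (0 : Matrix κ κ R)).det
      = (-1) ^ Fintype.card κ := by
  have h : fromBlocks (1 : Matrix κ κ R) (1 : Matrix κ κ R) (0 : Matrix κ κ R) (1 : Matrix κ κ R)
        * fromBlocks (0 : Matrix κ κ R) (1 : Matrix κ κ R) (1 : Matrix κ κ R) (0 : Matrix κ κ R)
        * fromBlocks (1 : Matrix κ κ R) (-1 : Matrix κ κ R) (0 : Matrix κ κ R) (1 : Matrix κ κ R)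
      = fromBlocks (1 : Matrix κ κ R) (0 : Matrix κ κ R) (1 : Matrix κ κ R) (-1 : Matrix κ κ R) := by
    simp [fromBlocks_multiply]
  have hd := congrArg det h
  simpa [det_neg] using hd

/-- CORE ELIMINATION IDENTITY (adapted coordinates, the `σ`-columns of the constraint already zero): for a form `A` on
`σ ⊕ κ` and a `κ × κ` block `q` with `det q` a unit,
`det [[A, [0 ; qᵀ]], [[0 | q], 0]] = (−1)^{card κ} · det A_σσ · (det q)²`. [folklore] -/
theorem det_bordered_core (A : Matrix (σ ⊕ κ) (σ ⊕ κ) R) (q : Matrix κ κ R) (hq : IsUnit q.det) :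
    (fromBlocks A (fromRows (0 : Matrix σ κ R) qᵀ) (fromCols (0 : Matrix κ σ R) q) 0).det
      = (-1) ^ Fintype.card κ * A.toBlocks₁₁.det * q.det ^ 2 := by
  have hqT : IsUnit qᵀ.det := by rwa [det_transpose]
  obtain ⟨a, b, c, d, rfl⟩ : ∃ a b c d, A = fromBlocks a b c d :=
    ⟨_, _, _, _, (fromBlocks_toBlocks A).symm⟩
  rw [toBlocks_fromBlocks₁₁]
  -- row operation (kill `b`) and column operation (kill `c`) with the invertible block `q`
  have key :
      (fromBlocks (1 : Matrix (σ ⊕ κ) (σ ⊕ κ) R) (fromRows (-(b * q⁻¹)) (0 : Matrix κ κ R))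
          (0 : Matrix κ (σ ⊕ κ) R) (1 : Matrix κ κ R))
        * fromBlocks (fromBlocks a b c d) (fromRows (0 : Matrix σ κ R) qᵀ) (fromCols (0 : Matrix κ σ R) q) 0
        * fromBlocks (1 : Matrix (σ ⊕ κ) (σ ⊕ κ) R) (0 : Matrix (σ ⊕ κ) κ R)
          (fromCols (-(qᵀ⁻¹ * c)) (0 : Matrix κ κ R)) (1 : Matrix κ κ R)
      = fromBlocks (fromBlocks a 0 0 d) (fromRows (0 : Matrix σ κ R) qᵀ) (fromCols (0 : Matrix κ σ R) q) 0 := by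
    simp only [fromBlocks_multiply, fromRows_mul_fromCols, Matrix.one_mul, Matrix.mul_one, Matrix.mul_zero,
      Matrix.zero_mul, add_zero, zero_add]
    simp [fromBlocks_add, nonsing_inv_mul_cancel_right q b hq, mul_nonsing_inv_cancel_left qᵀ c hqT]
  have hdet :
      (fromBlocks (fromBlocks a b c d) (fromRows (0 : Matrix σ κ R) qᵀ) (fromCols (0 : Matrix κ σ R) q) 0).det
        = (fromBlocks (fromBlocks a 0 0 d) (fromRows (0 : Matrix σ κ R) qᵀ)
            (fromCols (0 : Matrix κ σ R) q) 0).det := by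
    have := congrArg det key
    simpa using this
  -- re-associate the index type and split off the `σσ` block
  have hre : fromBlocks (fromBlocks a 0 0 d) (fromRows (0 : Matrix σ κ R) qᵀ)
        (fromCols (0 : Matrix κ σ R) q) (0 : Matrix κ κ R)
      = (fromBlocks a 0 0 (fromBlocks d qᵀ q 0)).submatrix (Equiv.sumAssoc σ κ κ) (Equiv.sumAssoc σ κ κ) := by
    rw [fromBlocks_fromBlocks_eq_submatrix, fromCols_zero, fromRows_zero]
  -- the `κ ⊕ κ` corner factors through the anti-diagonal swap
  have hM : fromBlocks d qᵀ q (0 : Matrix κ κ R)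
      = fromBlocks qᵀ d 0 q * fromBlocks (0 : Matrix κ κ R) (1 : Matrix κ κ R) (1 : Matrix κ κ R) 0 := by
    simp [fromBlocks_multiply]
  rw [hdet, hre, det_submatrix_equiv_self, det_fromBlocks_zero₂₁, hM, det_mul, det_fromBlocks_zero₂₁,
    det_fromBlocks_zero_one_one_zero, det_transpose]
  ring

omit [DecidableEq σ] in
/-- The congruence `diag([Z|Y], 1)ᵀ · [[Δ,Qᵀ],[Q,0]] · diag([Z|Y], 1)` in block form. [folklore] -/
theorem bordered_congr (Δ : Matrix (σ ⊕ κ) (σ ⊕ κ) R) (Q : Matrix κ (σ ⊕ κ) R)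
    (Z : Matrix (σ ⊕ κ) σ R) (Y : Matrix (σ ⊕ κ) κ R) :
    fromBlocks (fromCols Z Y)ᵀ 0 0 (1 : Matrix κ κ R) * fromBlocks Δ Qᵀ Q 0
        * fromBlocks (fromCols Z Y) 0 0 (1 : Matrix κ κ R)
      = fromBlocks ((fromCols Z Y)ᵀ * Δ * fromCols Z Y) (fromRows (Q * Z)ᵀ (Q * Y)ᵀ)
          (fromCols (Q * Z) (Q * Y)) 0 := by
  simp [fromBlocks_multiply, transpose_fromCols, transpose_mul]

omit [DecidableEq σ] [DecidableEq κ] in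
/-- The `σσ` block of `[Z|Y]ᵀ Δ [Z|Y]` is `ZᵀΔZ`. [folklore] -/
theorem toBlocks₁₁_basis_conj (Δ : Matrix (σ ⊕ κ) (σ ⊕ κ) R) (Z : Matrix (σ ⊕ κ) σ R)
    (Y : Matrix (σ ⊕ κ) κ R) :
    ((fromCols Z Y)ᵀ * Δ * fromCols Z Y).toBlocks₁₁ = Zᵀ * Δ * Z := by
  simp [transpose_fromCols]

/-- GENERAL-BASIS FORM of the elimination (the Jacobian of an ARBITRARY elimination of the constraint): for `Z` with
`QZ = 0` (columns in `ker Q`) and `Y` with `det(QY)` a unit,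
`det [[Δ,Qᵀ],[Q,0]] · det[Z|Y]² = (−1)^{card κ} · det(ZᵀΔZ) · det(QY)²`. [folklore] -/
theorem det_bordered_mul_det_basis_sq (Δ : Matrix (σ ⊕ κ) (σ ⊕ κ) R) (Q : Matrix κ (σ ⊕ κ) R)
    (Z : Matrix (σ ⊕ κ) σ R) (Y : Matrix (σ ⊕ κ) κ R) (hZ : Q * Z = 0) (hY : IsUnit (Q * Y).det) :
    (fromBlocks Δ Qᵀ Q 0).det * (fromCols Z Y).det ^ 2
      = (-1) ^ Fintype.card κ * (Zᵀ * Δ * Z).det * (Q * Y).det ^ 2 := by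
  have h := congrArg det (bordered_congr Δ Q Z Y)
  rw [hZ] at h
  simp only [det_mul, det_fromBlocks_zero₂₁, det_one, mul_one, det_transpose, transpose_zero] at h
  rw [det_bordered_core _ _ hY, toBlocks₁₁_basis_conj] at h
  rw [← h]
  ring

/-- Bałaban's elimination matrix in adapted coordinates: `C = [1 ; −Q_κ⁻¹ Q_σ]` — "an identity operator on almost all
bonds, except the bonds b₀ for which a value (CB̃)(b₀) is equal to a solution of the equation (QB)(c) = 0, considered
as an equation on the variable B(b₀)" [Balaban1985BackgroundPropagators] p. 428; [Balaban1987RG1] p. 268 "B′ = CB".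
A DEFINITION over an abstract coordinate splitting (READING D-pv03.8); nothing is asserted.
[cite: Balaban1985BackgroundPropagators, (3.157) p.428] -/
noncomputable def elim (Qσ : Matrix κ σ R) (Qκ : Matrix κ κ R) : Matrix (σ ⊕ κ) σ R :=
  fromRows 1 (-(Qκ⁻¹ * Qσ))

/-- `C` is the identity on the retained coordinates `σ`. [cite: Balaban1985BackgroundPropagators, (3.157) p.428] -/
theorem elim_mulVec_inl (Qσ : Matrix κ σ R) (Qκ : Matrix κ κ R) (v : σ → R) (s : σ) :
    (elim Qσ Qκ *ᵥ v) (Sum.inl s) = v s := by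
  simp [elim, fromRows_mulVec]

/-- The columns of `C` lie in the kernel of the constraint: `[Q_σ | Q_κ] · C = 0` (needs `det Q_κ` a unit).
[cite: Balaban1985BackgroundPropagators, (3.157) p.428] -/
theorem constraint_mul_elim (Qσ : Matrix κ σ R) (Qκ : Matrix κ κ R) (hκ : IsUnit Qκ.det) :
    fromCols Qσ Qκ * elim Qσ Qκ = 0 := by
  simp [elim, fromCols_mul_fromRows, mul_nonsing_inv_cancel_left Qκ Qσ hκ]

/-- `C v` solves the constraint `(QB)(c) = 0`. [cite: Balaban1985BackgroundPropagators, (3.157) p.428] -/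
theorem constraint_mulVec_elim (Qσ : Matrix κ σ R) (Qκ : Matrix κ κ R) (hκ : IsUnit Qκ.det) (v : σ → R) :
    fromCols Qσ Qκ *ᵥ (elim Qσ Qκ *ᵥ v) = 0 := by
  rw [mulVec_mulVec, constraint_mul_elim Qσ Qκ hκ, zero_mulVec]

/-- UNIQUENESS of the elimination: a vector that agrees with `v` on the retained coordinates and solves the constraint
IS `C v` (when `det Q_κ` is a unit) — the quoted definition of `C` determines it.
[cite: Balaban1985BackgroundPropagators, (3.157) p.428] -/
theorem elim_unique (Qσ : Matrix κ σ R) (Qκ : Matrix κ κ R) (hκ : IsUnit Qκ.det) (v : σ → R)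
    (w : σ ⊕ κ → R) (hσ : ∀ s, w (Sum.inl s) = v s) (hw : fromCols Qσ Qκ *ᵥ w = 0) :
    w = elim Qσ Qκ *ᵥ v := by
  have hv : w ∘ Sum.inl = v := funext hσ
  rw [fromCols_mulVec, hv] at hw
  have hu : w ∘ Sum.inr = -((Qκ⁻¹ * Qσ) *ᵥ v) := by
    have h2 := congrArg (fun x => Qκ⁻¹ *ᵥ x) hw
    simp only [mulVec_add, mulVec_mulVec, nonsing_inv_mul _ hκ, one_mulVec, mulVec_zero] at h2
    exact eq_neg_of_add_eq_zero_right h2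
  ext (s | k)
  · simp [elim, fromRows_mulVec, hσ]
  · have := congrFun hu k
    simpa [elim, fromRows_mulVec, neg_mulVec] using this

omit [DecidableEq σ] in
/-- The complementary coordinate block: `[Q_σ | Q_κ] · [0 ; 1] = Q_κ`. [folklore] -/
theorem constraint_mul_compl (Qσ : Matrix κ σ R) (Qκ : Matrix κ κ R) :
    fromCols Qσ Qκ * fromRows (0 : Matrix σ κ R) (1 : Matrix κ κ R) = Qκ := by
  simp [fromCols_mul_fromRows]

/-- The adapted change of variables `[C | [0;1]] = [[1,0],[−Q_κ⁻¹Q_σ, 1]]` is unimodular. [folklore] -/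
theorem det_fromCols_elim_compl (Qσ : Matrix κ σ R) (Qκ : Matrix κ κ R) :
    (fromCols (elim Qσ Qκ) (fromRows (0 : Matrix σ κ R) (1 : Matrix κ κ R))).det = 1 := by
  have : fromCols (elim Qσ Qκ) (fromRows (0 : Matrix σ κ R) (1 : Matrix κ κ R))
      = fromBlocks 1 0 (-(Qκ⁻¹ * Qσ)) 1 := by
    rw [elim, fromCols_fromRows_eq_fromBlocks]
  rw [this, det_fromBlocks_zero₁₂, det_one, det_one, mul_one]

/-- CONSTRAINT ELIMINATION FOR THE BORDERED DETERMINANT (Bałaban's `C`, adapted coordinates): with `Q = [Q_σ | Q_κ]`,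
`det Q_κ` a unit and `C = elim Q_σ Q_κ`,  `det [[Δ,Qᵀ],[Q,0]] = (−1)^{card κ} · det(CᵀΔC) · (det Q_κ)²`.  This is the
exact finite-dimensional content of "B′ = CB … the measure becomes a Gaussian measure in variables B, with the
covariance (C*Δ^{(k)}C)^{−1}" [Balaban1987RG1] p. 268 at the level of normalisations; `(det Q_κ)²` is the squared
Jacobian of the elimination. [folklore] -/
theorem det_bordered_eq (Δ : Matrix (σ ⊕ κ) (σ ⊕ κ) R) (Qσ : Matrix κ σ R) (Qκ : Matrix κ κ R)
    (hκ : IsUnit Qκ.det) :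
    (fromBlocks Δ (fromCols Qσ Qκ)ᵀ (fromCols Qσ Qκ) 0).det
      = (-1) ^ Fintype.card κ * ((elim Qσ Qκ)ᵀ * Δ * elim Qσ Qκ).det * Qκ.det ^ 2 := by
  have h := det_bordered_mul_det_basis_sq Δ (fromCols Qσ Qκ) (elim Qσ Qκ)
    (fromRows (0 : Matrix σ κ R) (1 : Matrix κ κ R))
    (constraint_mul_elim Qσ Qκ hκ) (by rwa [constraint_mul_compl])
  rwa [det_fromCols_elim_compl, constraint_mul_compl, one_pow, mul_one] at h

omit [DecidableEq σ] [DecidableEq κ] in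
/-- Transport of the reduced form: `(C∘e)ᵀ Δ (C∘e) = Cᵀ (e·Δ·e⁻¹) C`. [folklore] -/
theorem transpose_submatrix_mul_mul_submatrix {n : Type*} [Fintype n] {ρ : Type*}
    (Δ : Matrix n n R) (C : Matrix (σ ⊕ κ) ρ R) (e : n ≃ σ ⊕ κ) :
    (C.submatrix e id)ᵀ * Δ * C.submatrix e id = Cᵀ * reindex e e Δ * C := by
  have hΔ : Δ = (reindex e e Δ).submatrix e e := by
    simp [reindex_apply, submatrix_submatrix]
  conv_lhs => rw [hΔ, transpose_submatrix]
  rw [submatrix_mul_equiv, submatrix_mul_equiv, submatrix_id_id]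

end CommRing

/-! ## Part 2 — over a field: non-degeneracy transfers through the elimination -/

section Field

variable {K : Type*} [Field K]
variable {σ κ : Type*} [Fintype σ] [Fintype κ] [DecidableEq σ] [DecidableEq κ]

/-- Over a field, with `det Q_κ ≠ 0`: the bordered matrix is non-degenerate iff the reduced form `CᵀΔC` is.
[folklore] -/
theorem det_bordered_ne_zero_iff (Δ : Matrix (σ ⊕ κ) (σ ⊕ κ) K) (Qσ : Matrix κ σ K) (Qκ : Matrix κ κ K)
    (hκ : Qκ.det ≠ 0) :
    (fromBlocks Δ (fromCols Qσ Qκ)ᵀ (fromCols Qσ Qκ) 0).det ≠ 0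
      ↔ ((elim Qσ Qκ)ᵀ * Δ * elim Qσ Qκ).det ≠ 0 := by
  rw [det_bordered_eq Δ Qσ Qκ (isUnit_iff_ne_zero.mpr hκ)]
  have h1 : ((-1 : K) ^ Fintype.card κ) ≠ 0 := pow_ne_zero _ (neg_ne_zero.mpr one_ne_zero)
  have h2 : Qκ.det ^ 2 ≠ 0 := pow_ne_zero _ hκ
  simp [h1, h2]

end Field

/-! ## Part 3 — real corollaries: the Jacobian in `log |det|` form -/

section Real

variable {σ κ : Type*} [Fintype σ] [Fintype κ] [DecidableEq σ] [DecidableEq κ]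

/-- `|det [[Δ,Qᵀ],[Q,0]]| = |det(CᵀΔC)| · (det Q_κ)²` over `ℝ`. [folklore] -/
theorem abs_det_bordered_eq (Δ : Matrix (σ ⊕ κ) (σ ⊕ κ) ℝ) (Qσ : Matrix κ σ ℝ) (Qκ : Matrix κ κ ℝ)
    (hκ : Qκ.det ≠ 0) :
    |(fromBlocks Δ (fromCols Qσ Qκ)ᵀ (fromCols Qσ Qκ) 0).det|
      = |((elim Qσ Qκ)ᵀ * Δ * elim Qσ Qκ).det| * Qκ.det ^ 2 := by
  rw [det_bordered_eq Δ Qσ Qκ (isUnit_iff_ne_zero.mpr hκ), abs_mul, abs_mul, abs_pow, abs_pow, abs_neg,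
    abs_one, one_pow, one_mul, sq_abs]

/-- THE JACOBIAN OF THE ELIMINATION in logarithmic form:
`log|det [[Δ,Qᵀ],[Q,0]]| = log|det(CᵀΔC)| + 2·log|det Q_κ|` (both determinants non-zero).  With the READINGS of the
header (`−½·log|det K|` ↔ `log Z^{(k)}` up to `((n−m)/2) log 2π`, `−½·log det(CᵀΔC)` ↔ `log Z′^{(k)}`), this is
"`Z^{(k)}(U) = Z′^{(k)}(U) / |det Q_κ(U)|`". [folklore] -/
theorem log_abs_det_bordered_eq (Δ : Matrix (σ ⊕ κ) (σ ⊕ κ) ℝ) (Qσ : Matrix κ σ ℝ) (Qκ : Matrix κ κ ℝ)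
    (hκ : Qκ.det ≠ 0) (hC : ((elim Qσ Qκ)ᵀ * Δ * elim Qσ Qκ).det ≠ 0) :
    Real.log |(fromBlocks Δ (fromCols Qσ Qκ)ᵀ (fromCols Qσ Qκ) 0).det|
      = Real.log |((elim Qσ Qκ)ᵀ * Δ * elim Qσ Qκ).det| + 2 * Real.log |Qκ.det| := by
  rw [abs_det_bordered_eq Δ Qσ Qκ hκ, Real.log_mul (abs_ne_zero.mpr hC) (pow_ne_zero 2 hκ), Real.log_pow,
    ← Real.log_abs (Qκ.det)]
  push_cast
  ring

/-- LOCALITY of the Jacobian: if the eliminated block `Q_κ` is block-diagonal over the coarse bonds `c` (READING of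
"LQ̃h = I" with `h` acting bond-wise, [Balaban1987RG1] p. 267), then `|det Q_κ| = ∏_c |det q_c|`. [folklore] -/
theorem abs_det_blockDiagonal {o ι : Type*} [Fintype o] [DecidableEq o] [Fintype ι] [DecidableEq ι]
    (q : o → Matrix ι ι ℝ) : |(blockDiagonal q).det| = ∏ c, |(q c).det| := by
  rw [det_blockDiagonal, Finset.abs_prod]

/-- INVARIANCE CRITERION for one block: if `q = t • O` with `OᵀO = 1` (e.g. a scalar times the adjoint action of a
group element in a tr-orthonormal basis of 𝔤), then `|det q| = |t|^{dim}` does not depend on `O` — such a Jacobian is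
background-free and cancels in `log Z^{(k)}(U) − log Z^{(k)}(1)`.  Whether Bałaban's coefficient has this shape is NOT
asserted here. [folklore] -/
theorem abs_det_smul_of_transpose_mul_self_eq_one {ι : Type*} [Fintype ι] [DecidableEq ι] (t : ℝ)
    (O : Matrix ι ι ℝ) (hO : Oᵀ * O = 1) : |(t • O).det| = |t| ^ Fintype.card ι := by
  have h1 : O.det ^ 2 = 1 ^ 2 := by
    have := congrArg det hO
    rwa [det_mul, det_transpose, det_one, ← sq, ← one_pow 2] at this
  have h2 : |O.det| = 1 := by
    have := (sq_eq_sq_iff_abs_eq_abs _ _).mp h1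
    rwa [abs_one] at this
  rw [det_smul, abs_mul, abs_pow, h2, mul_one]

end Real

end Literature.MathematicalPhysics.QuantumFieldTheory.Balaban1983to89.Beta.ConstraintElimination

/-! ## Part 4 — bridge to the landed objects of `Beta.OneLoop` (`ConstrainedGaussian.kkt / logZ / reduced / logZred`) -/

namespace Literature.MathematicalPhysics.QuantumFieldTheory.Balaban1983to89.Beta.ConstrainedGaussian

open Matrix ConstraintElimination

variable {n m r : ℕ}

/-- Adapted coordinates `e : Fin n ≃ Fin r ⊕ Fin m` (READING D-pv03.8: `Fin m` ↔ the eliminated coordinates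
`B′(b₀(c))`, `Fin r` ↔ "the remaining variables"): the block `Q_σ` of the constraint on the retained coordinates.
[cite: Balaban1987RG1, (1.4) p.260] -/
def constraintRetained (Z : ConstrainedGaussian n m) (e : Fin n ≃ Fin r ⊕ Fin m) : Matrix (Fin m) (Fin r) ℝ :=
  (reindex (Equiv.refl (Fin m)) e Z.Q).toCols₁

/-- Adapted coordinates: the square block `Q_κ` of the constraint on the eliminated coordinates ("a coefficient at the
variable B′(b₀(c)) in (Q̃B′)(c)" [Balaban1987RG1] p. 267, all `c` at once). [cite: Balaban1987RG1, (1.4) p.260] -/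
def constraintEliminated (Z : ConstrainedGaussian n m) (e : Fin n ≃ Fin r ⊕ Fin m) :
    Matrix (Fin m) (Fin m) ℝ :=
  (reindex (Equiv.refl (Fin m)) e Z.Q).toCols₂

/-- Bałaban's `C` ("B′ = CB" [Balaban1987RG1] p. 268) as an `n × r` real matrix in the ORIGINAL coordinates:
`elim Q_σ Q_κ` transported back along `e`. [cite: Balaban1985BackgroundPropagators, (3.157) p.428] -/
noncomputable def elimMatrix (Z : ConstrainedGaussian n m) (e : Fin n ≃ Fin r ⊕ Fin m) :
    Matrix (Fin n) (Fin r) ℝ :=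
  (elim (Z.constraintRetained e) (Z.constraintEliminated e)).submatrix e id

/-- In adapted coordinates the constraint reads `[Q_σ | Q_κ]`. [folklore] -/
theorem reindex_Q_eq_fromCols (Z : ConstrainedGaussian n m) (e : Fin n ≃ Fin r ⊕ Fin m) :
    reindex (Equiv.refl (Fin m)) e Z.Q = fromCols (Z.constraintRetained e) (Z.constraintEliminated e) :=
  (fromCols_toCols _).symm

/-- The bordered matrix in adapted coordinates. [folklore] -/
theorem reindex_kkt_eq (Z : ConstrainedGaussian n m) (e : Fin n ≃ Fin r ⊕ Fin m) :
    reindex (e.sumCongr (Equiv.refl (Fin m))) (e.sumCongr (Equiv.refl (Fin m))) Z.kkt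
      = fromBlocks (reindex e e Z.Δ) (fromCols (Z.constraintRetained e) (Z.constraintEliminated e))ᵀ
          (fromCols (Z.constraintRetained e) (Z.constraintEliminated e)) 0 := by
  rw [kkt, bordered_reindex, reindex_Q_eq_fromCols]

/-- The reduced form of `Beta.OneLoop` at Bałaban's `C` is the adapted-coordinates `CᵀΔC`. [folklore] -/
theorem reduced_elimMatrix (Z : ConstrainedGaussian n m) (e : Fin n ≃ Fin r ⊕ Fin m) :
    Z.reduced (Z.elimMatrix e)
      = (elim (Z.constraintRetained e) (Z.constraintEliminated e))ᵀ * reindex e e Z.Δ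
          * elim (Z.constraintRetained e) (Z.constraintEliminated e) := by
  rw [reduced, elimMatrix, transpose_submatrix_mul_mul_submatrix]

/-- `det Z.kkt = (−1)^m · det(Z.reduced C) · (det Q_κ)²` for Bałaban's `C` in any adapted splitting with
`det Q_κ ≠ 0`. [folklore] -/
theorem det_kkt_eq_of_adapted (Z : ConstrainedGaussian n m) (e : Fin n ≃ Fin r ⊕ Fin m)
    (hκ : (Z.constraintEliminated e).det ≠ 0) :
    Z.kkt.det = (-1) ^ m * (Z.reduced (Z.elimMatrix e)).det * (Z.constraintEliminated e).det ^ 2 := by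
  rw [← det_reindex_self (e.sumCongr (Equiv.refl (Fin m))) Z.kkt, reindex_kkt_eq,
    det_bordered_eq _ _ _ (isUnit_iff_ne_zero.mpr hκ), reduced_elimMatrix, Fintype.card_fin]

/-- An adapted splitting forces `n = r + m` ("n − m remaining variables"). [folklore] -/
theorem eq_add_of_adapted (e : Fin n ≃ Fin r ⊕ Fin m) : n = r + m := by
  simpa using Fintype.card_congr e

/-- THE EXACT JACOBIAN between the two printed normalisations (lead NOTE 2026-08-18T17:45:57Z, OBJECTS.md §5(a)):
for `Z : ConstrainedGaussian n m`, an adapted splitting `e` with `det Q_κ ≠ 0` and `det(CᵀΔC) ≠ 0`,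
`Z.logZ = Z.logZred C − log|det Q_κ|`, i.e. "Z^{(k)}(U) = Z′^{(k)}(U) / |det Q_κ(U)|" with `C` = Bałaban's `C`.
The correction depends on the background through `Q̃(U)` only. [folklore] -/
theorem logZ_eq_logZred_sub_log (Z : ConstrainedGaussian n m) (e : Fin n ≃ Fin r ⊕ Fin m)
    (hκ : (Z.constraintEliminated e).det ≠ 0) (hC : (Z.reduced (Z.elimMatrix e)).det ≠ 0) :
    Z.logZ = Z.logZred (Z.elimMatrix e) - Real.log |(Z.constraintEliminated e).det| := by
  have hn : ((n : ℝ) - m) = r := by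
    rw [eq_add_of_adapted e]; push_cast; ring
  rw [logZ, logZred, hn, det_kkt_eq_of_adapted Z e hκ, abs_mul, abs_mul, abs_pow, abs_pow, abs_neg, abs_one,
    one_pow, one_mul, Real.log_mul (abs_ne_zero.mpr hC) (pow_ne_zero 2 (abs_ne_zero.mpr hκ)), Real.log_pow]
  simp only [Real.log_abs]
  push_cast
  ring

end Literature.MathematicalPhysics.QuantumFieldTheory.Balaban1983to89.Beta.ConstrainedGaussian
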